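import Summits.CriticalPhenomena.PercolationContinuityZ3.Theorems.PercNearOneGluingNoHeavyLowerTailMergeGainTools
import HarnessLib

/-!
# `NoHeavyLowerTail` (stmt-CriticalPhenomena-4575) — QUANTITATIVE gluing: the gap form of Kozma–Nitzan's Lemma 3(i)
# and of the up-set exchange (a strict comparison survives gluing with the factor `μ(a ↮ v)`)

Support file (lemma factory `prim-lf-3` gen 7, seat g9; `--supports stmt-CriticalPhenomena-4575`).  No definitions, no
named facts, no sorries.  Memo: `run/shared/lean/prim/prim-lf-3/LF3-BETA-R.md` §4 (NO-ALL-BAD lemma), §6(a).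

* `knLemma3i_gap` — if `μ(a₁↔b) + γ ≤ μ(a₂↔b) + d` (`γ, d ≥ 0`) and `Q` is increasing in the open edge cluster of `a₂`, then
  `μ(a₁↔b, Q) + γ·μ(a₁↮a₂, Q) ≤ μ(a₂↔b, Q) + d·μ(Q)`.  Same two BHK inequalities as `knLemma3i`; the gap `γ` is carried by the
  factor `μ(D ∩ Q)/μ(D) ≥ μ(D ∩ Q)`, `D = {a₁ ↮ a₂}`.
* `upsetExchange_event_gap` — `μ_w(a↔b) + γ ≤ μ_w(v↔b)` ⟹ `μ_{glue_S w}(a↔b, E) + γ·μ_{glue_S w}(a↮v, E) ≤ μ_{glue_S w}(v↔b, E)` for every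
  event `E` with `E ∩ {S internally open}` increasing in the open edge cluster of `v` (sprinkling proof of `upsetExchange_event` verbatim).
* `pairGlue_gap` — Lemma 5 for one pair with a gap: `μ_g(j↔b) + γ ≤ μ_g(c↔b)` ⟹ `μ_{g⁺}(j↔b) + γ·μ_{g⁺}(j↮c) ≤ μ_{g⁺}(c↔b)`, `g⁺ = g[s(c,d) ↦ 1]`.
-/

namespace Summit.CriticalPhenomena.PercolationContinuityZ3.Theorems

open MeasureTheory Set ProbabilityTheory Filter Topology
open Literature.Probability.LatticeModels
open Literature.Probability.Percolation

noncomputable section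
open Classical

namespace UpsetExchange

variable {n : ℕ}

/-- **KN Lemma 3(i) with a gap.** [cite: KozmaNitzan2024, Lemma 3(i) (pp. 6–7); VandenbergHaggstromKahn2005, Thm. 1.3, Thm. 1.4] -/
theorem knLemma3i_gap (w : Sym2 (Fin n) → unitInterval) (a₁ a₂ b : Fin n) (Q : Set (BondConfig (Fin n))) {γ d : ℝ}
    (hQ : ∀ ω ω', ω ∈ Q → openEdgeCluster ω a₂ ⊆ openEdgeCluster ω' a₂ → ω' ∈ Q)
    (hγ : 0 ≤ γ) (hd : 0 ≤ d)
    (hle : (prodBernoulli w).real (openConn a₁ b) + γ ≤ (prodBernoulli w).real (openConn a₂ b) + d) :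
    (prodBernoulli w).real (openConn a₁ b ∩ Q) + γ * (prodBernoulli w).real ((openConn a₁ a₂)ᶜ ∩ Q) ≤
      (prodBernoulli w).real (openConn a₂ b ∩ Q) + d * (prodBernoulli w).real Q := by
  rcases eq_or_ne a₁ a₂ with h12 | h12
  · subst h12
    have h0 : (prodBernoulli w).real ((openConn a₁ a₁)ᶜ ∩ Q) = 0 := by
      have : ((openConn a₁ a₁)ᶜ ∩ Q : Set (BondConfig (Fin n))) = ∅ := by
        ext ω; simp only [mem_inter_iff, mem_compl_iff, mem_empty_iff_false, iff_false, not_and]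
        intro h; exact absurd (SimpleGraph.Reachable.refl a₁ : (openGraph ω).Reachable a₁ a₁) h
      rw [this, measureReal_empty]
    rw [h0, mul_zero, add_zero]
    have : γ ≤ d := by linarith
    exact le_add_of_nonneg_right (mul_nonneg hd measureReal_nonneg)
  have hDm : MeasurableSet ((openConn a₁ a₂)ᶜ : Set (BondConfig (Fin n))) := MeasurableSet.of_discrete
  have hagree : ∀ E : Set (BondConfig (Fin n)),
      (openConn a₁ b ∩ E) \ (openConn a₁ a₂)ᶜ = (openConn a₂ b ∩ E) \ (openConn a₁ a₂)ᶜ := by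
    intro E
    ext ω
    simp only [Set.mem_sdiff, Set.mem_inter_iff, Set.mem_compl_iff, not_not]
    constructor
    · rintro ⟨⟨h1, hE⟩, h2⟩
      exact ⟨⟨SimpleGraph.Reachable.trans (SimpleGraph.Reachable.symm h2) h1, hE⟩, h2⟩
    · rintro ⟨⟨h1, hE⟩, h2⟩
      exact ⟨⟨SimpleGraph.Reachable.trans h2 h1, hE⟩, h2⟩
  have hs1 := measureReal_inter_add_sdiff (μ := prodBernoulli w) (s := openConn a₁ b) hDm
  have hs2 := measureReal_inter_add_sdiff (μ := prodBernoulli w) (s := openConn a₂ b) hDm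
  have hs1Q := measureReal_inter_add_sdiff (μ := prodBernoulli w) (s := openConn a₁ b ∩ Q) hDm
  have hs2Q := measureReal_inter_add_sdiff (μ := prodBernoulli w) (s := openConn a₂ b ∩ Q) hDm
  have he : (prodBernoulli w).real (openConn a₁ b \ (openConn a₁ a₂)ᶜ) =
      (prodBernoulli w).real (openConn a₂ b \ (openConn a₁ a₂)ᶜ) := by
    have h := hagree Set.univ
    simp only [Set.inter_univ] at h
    rw [h]
  have heQ : (prodBernoulli w).real ((openConn a₁ b ∩ Q) \ (openConn a₁ a₂)ᶜ) =
      (prodBernoulli w).real ((openConn a₂ b ∩ Q) \ (openConn a₁ a₂)ᶜ) := by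
    rw [hagree Q]
  rw [Set.inter_comm (openConn a₁ b) (openConn a₁ a₂)ᶜ] at hs1
  rw [Set.inter_comm (openConn a₂ b) (openConn a₁ a₂)ᶜ] at hs2
  rw [Set.inter_comm (openConn a₁ b ∩ Q) (openConn a₁ a₂)ᶜ] at hs1Q
  rw [Set.inter_comm (openConn a₂ b ∩ Q) (openConn a₁ a₂)ᶜ] at hs2Q
  have hI := knLemma3i_oneCluster w a₂ a₁ b Q hQ h12.symm
  have hcomm : (openConn a₂ a₁ : Set (BondConfig (Fin n))) = openConn a₁ a₂ :=
    Set.ext fun _ => ⟨fun h => SimpleGraph.Reachable.symm h, fun h => SimpleGraph.Reachable.symm h⟩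
  rw [hcomm] at hI
  have hII := knLemma3i_twoCluster w a₁ a₂ b Q hQ h12
  have hQu : IsUpperSet Q := fun ω ω' hωω' hω => hQ ω ω' hω (BHK2006.openEdgeCluster_mono hωω' a₂)
  have hDl : IsLowerSet ((openConn a₁ a₂)ᶜ : Set (BondConfig (Fin n))) := (isUpperSet_openConn a₁ a₂).compl
  have hH := Literature.Probability.LatticeModels.prodBernoulli_harris_upper_lower w hQu hDl
    MeasurableSet.of_discrete hDm
  rw [Set.inter_comm Q (openConn a₁ a₂)ᶜ] at hH
  set m := (prodBernoulli w).real ((openConn a₁ a₂)ᶜ : Set (BondConfig (Fin n))) with hm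
  set q := (prodBernoulli w).real ((openConn a₁ a₂)ᶜ ∩ Q) with hq
  set x₁ := (prodBernoulli w).real ((openConn a₁ a₂)ᶜ ∩ openConn a₁ b) with hx₁
  set x₂ := (prodBernoulli w).real ((openConn a₁ a₂)ᶜ ∩ openConn a₂ b) with hx₂
  set y₁ := (prodBernoulli w).real ((openConn a₁ a₂)ᶜ ∩ (openConn a₁ b ∩ Q)) with hy₁
  set y₂ := (prodBernoulli w).real ((openConn a₁ a₂)ᶜ ∩ (openConn a₂ b ∩ Q)) with hy₂
  have hx : x₁ + γ ≤ x₂ + d := by linarith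
  have hm1 : m ≤ 1 := measureReal_le_one
  have hq0 : 0 ≤ q := measureReal_nonneg
  have hqm : q ≤ m := measureReal_mono Set.inter_subset_left (measure_ne_top _ _)
  have hQ0 : 0 ≤ (prodBernoulli w).real Q := measureReal_nonneg
  -- `m y₁ ≤ x₁ q ≤ (x₂ + d − γ) q ≤ m y₂ + d μ(Q) m − γ q`, and `γ q ≥ γ q m`... we show `y₁ + γ q ≤ y₂ + d μ(Q)`
  have hfin : y₁ + γ * q ≤ y₂ + d * (prodBernoulli w).real Q := by
    rcases eq_or_lt_of_le (measureReal_nonneg : 0 ≤ m) with hm0 | hmpos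
    · have hy1 : y₁ = 0 := measureReal_mono_null Set.inter_subset_left hm0.symm
      have hq' : q = 0 := measureReal_mono_null Set.inter_subset_left hm0.symm
      rw [hy1, hq', mul_zero, add_zero]
      exact add_nonneg measureReal_nonneg (mul_nonneg hd hQ0)
    · -- from the two BHK inequalities
      have h1 : m * y₁ ≤ x₁ * q := hII
      have h2 : x₂ * q ≤ m * y₂ := hI
      have hx' : x₁ * q + γ * q ≤ x₂ * q + d * q := by
        calc x₁ * q + γ * q = (x₁ + γ) * q := by ring
          _ ≤ (x₂ + d) * q := mul_le_mul_of_nonneg_right hx hq0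
          _ = x₂ * q + d * q := by ring
      have h3 : m * y₁ + γ * q ≤ m * y₂ + d * q := by linarith [h1, h2, hx']
      have h4 : d * q ≤ d * ((prodBernoulli w).real Q * m) := mul_le_mul_of_nonneg_left hH hd
      have h6 : m * (γ * q) ≤ γ * q := by
        have := mul_le_mul_of_nonneg_right hm1 (mul_nonneg hγ hq0)
        linarith [this, one_mul (γ * q)]
      have h5 : m * (y₁ + γ * q) ≤ m * (y₂ + d * (prodBernoulli w).real Q) := by
        calc m * (y₁ + γ * q) = m * y₁ + m * (γ * q) := by ring
          _ ≤ m * y₁ + γ * q := by linarith [h6]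
          _ ≤ m * y₂ + d * q := by linarith [h3]
          _ ≤ m * y₂ + d * ((prodBernoulli w).real Q * m) := by linarith [h4]
          _ = m * (y₂ + d * (prodBernoulli w).real Q) := by ring
      exact le_of_mul_le_mul_left h5 hmpos
  linarith

/-- **Up-set exchange with a gap.**  See the module docstring.
[cite: KozmaNitzan2024, Lemma 5 and Lemma 3(i) (pp. 6, 13); VandenbergHaggstromKahn2005, Thm. 1.2] -/
theorem upsetExchange_event_gap (w : Sym2 (Fin n) → unitInterval) (S : Finset (Fin n)) (a b v : Fin n)
    (E : Set (BondConfig (Fin n))) {γ : ℝ} (hγ : 0 ≤ γ)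
    (hE : ∀ ω ω' : BondConfig (Fin n), ω ∈ E →
      (∀ e : Sym2 (Fin n), (∀ x ∈ e, x ∈ S) → ¬ e.IsDiag → e ∈ ω) →
      openEdgeCluster ω v ⊆ openEdgeCluster ω' v →
      ω' ∈ E ∧ ∀ e : Sym2 (Fin n), (∀ x ∈ e, x ∈ S) → ¬ e.IsDiag → e ∈ ω')
    (hyp : (prodBernoulli w).real (openConn a b) + γ ≤ (prodBernoulli w).real (openConn v b)) :
    (prodBernoulli (fun e : Sym2 (Fin n) => if (∀ x ∈ e, x ∈ S) ∧ ¬ e.IsDiag then 1 else w e)).real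
        (openConn a b ∩ E) +
      γ * (prodBernoulli (fun e : Sym2 (Fin n) => if (∀ x ∈ e, x ∈ S) ∧ ¬ e.IsDiag then 1 else w e)).real
        ((openConn a v)ᶜ ∩ E) ≤
      (prodBernoulli (fun e : Sym2 (Fin n) => if (∀ x ∈ e, x ∈ S) ∧ ¬ e.IsDiag then 1 else w e)).real
        (openConn v b ∩ E) := by
  classical
  set g : Sym2 (Fin n) → unitInterval := fun e => if (∀ x ∈ e, x ∈ S) ∧ ¬ e.IsDiag then 1 else w e with hg
  set D : Finset (Sym2 (Fin n)) := Finset.univ.filter (fun e => (∀ x ∈ e, x ∈ S) ∧ ¬ e.IsDiag) with hDdef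
  have hD : ∀ e, e ∈ D ↔ (∀ x ∈ e, x ∈ S) ∧ ¬ e.IsDiag := fun e => by simp [hDdef]
  set ED : Set (BondConfig (Fin n)) := {ω | (↑D : Set (Sym2 (Fin n))) ⊆ ω} with hEDdef
  set Q : Set (BondConfig (Fin n)) := E ∩ ED with hQdef
  have hQmono : ∀ ω ω', ω ∈ Q → openEdgeCluster ω v ⊆ openEdgeCluster ω' v → ω' ∈ Q := by
    intro ω ω' hω hsub
    have hF : ∀ e : Sym2 (Fin n), (∀ x ∈ e, x ∈ S) → ¬ e.IsDiag → e ∈ ω :=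
      fun e heS hed => hω.2 (Finset.mem_coe.2 ((hD e).2 ⟨heS, hed⟩))
    obtain ⟨hE', hF'⟩ := hE ω ω' hω.1 hF hsub
    refine ⟨hE', fun e he => ?_⟩
    have he' := (hD e).1 (Finset.mem_coe.1 he)
    exact hF' e he'.1 he'.2
  set u : unitInterval → Sym2 (Fin n) → unitInterval :=
    fun ε e => if e ∈ D then Set.Icc.convexComb (w e) 1 ε else w e with hu
  have hwu : ∀ ε, w ≤ u ε := by
    intro ε e
    by_cases he : e ∈ D
    · simp only [hu, he, if_true]
      exact Set.Icc.le_convexComb unitInterval.le_one' ε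
    · simp only [hu, he, if_false]
      exact le_rfl
  have hu0 : u 0 = w := by
    funext e
    by_cases he : e ∈ D
    · simp only [hu, he, if_true, Set.Icc.convexComb_zero]
    · simp only [hu, he, if_false]
  have hucont : Continuous u := by
    refine continuous_pi fun e => ?_
    by_cases he : e ∈ D
    · simp only [hu, he, if_true]
      exact Set.Icc.continuous_convexComb (w e) 1
    · simp only [hu, he, if_false]
      exact continuous_const
  have hpin : ∀ ε, (fun e => if e ∈ D then (1 : unitInterval) else u ε e) = g := by
    intro ε
    funext e
    by_cases he : e ∈ D
    · simp only [hg, he, if_true, if_pos ((hD e).1 he)]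
    · have he' : ¬ ((∀ x ∈ e, x ∈ S) ∧ ¬ e.IsDiag) := fun h => he ((hD e).2 h)
      simp only [hg, hu, he, if_false, if_neg he']
  have hcond : ∀ ε (X : Set (BondConfig (Fin n))),
      (prodBernoulli (u ε)).real (X ∩ Q) = (prodBernoulli (u ε)).real ED * (prodBernoulli g).real (X ∩ E) := by
    intro ε X
    rw [hQdef, ← inter_assoc, hEDdef, gluingLemma5_real_inter_allOpen (u ε) D MeasurableSet.of_discrete, hpin ε]
  have hcondQ : ∀ ε, (prodBernoulli (u ε)).real Q = (prodBernoulli (u ε)).real ED * (prodBernoulli g).real E := by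
    intro ε
    have := hcond ε univ
    rwa [univ_inter, univ_inter] at this
  have hpos : ∀ ε : unitInterval, 0 < (ε : ℝ) → 0 < (prodBernoulli (u ε)).real ED := by
    intro ε hε
    rw [hEDdef, prodBernoulli_real_subset (u ε) D]
    refine Finset.prod_pos fun e he => ?_
    simp only [hu, he, if_true, Set.Icc.coe_convexComb, Set.Icc.coe_one, mul_one]
    exact add_pos_of_nonneg_of_pos
      (mul_nonneg (unitInterval.one_minus_nonneg ε) (unitInterval.nonneg (w e))) hε
  -- the step at fixed `ε > 0`
  have hstep : ∀ ε : unitInterval, 0 < (ε : ℝ) →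
      (prodBernoulli g).real (openConn a b ∩ E) + γ * (prodBernoulli g).real ((openConn a v)ᶜ ∩ E) ≤
        (prodBernoulli g).real (openConn v b ∩ E) +
        ((prodBernoulli (u ε)).real (openConn a b) - (prodBernoulli w).real (openConn a b)) := by
    intro ε hε
    have hma : (prodBernoulli w).real (openConn a b) ≤ (prodBernoulli (u ε)).real (openConn a b) :=
      prodBernoulli_real_mono_of_isUpperSet (hwu ε) (isUpperSet_openConn a b) MeasurableSet.of_discrete
    have hmv : (prodBernoulli w).real (openConn v b) ≤ (prodBernoulli (u ε)).real (openConn v b) :=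
      prodBernoulli_real_mono_of_isUpperSet (hwu ε) (isUpperSet_openConn v b) MeasurableSet.of_discrete
    set d : ℝ := (prodBernoulli (u ε)).real (openConn a b) - (prodBernoulli w).real (openConn a b) with hdd
    have hd0 : 0 ≤ d := sub_nonneg.2 hma
    have h3 := knLemma3i_gap (u ε) a v b Q hQmono hγ hd0 (by linarith)
    rw [hcond ε (openConn a b), hcond ε (openConn v b), hcond ε (openConn a v)ᶜ, hcondQ ε] at h3
    have hEC1 : (prodBernoulli g).real E ≤ 1 := measureReal_le_one
    have hED0 : 0 ≤ (prodBernoulli (u ε)).real ED := measureReal_nonneg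
    have h4 : (prodBernoulli (u ε)).real ED *
        ((prodBernoulli g).real (openConn a b ∩ E) + γ * (prodBernoulli g).real ((openConn a v)ᶜ ∩ E)) ≤
        (prodBernoulli (u ε)).real ED * ((prodBernoulli g).real (openConn v b ∩ E) + d) := by
      nlinarith [h3, mul_le_mul_of_nonneg_left hEC1 (mul_nonneg hd0 hED0)]
    exact le_of_mul_le_mul_left h4 (hpos ε hε)
  -- `ε → 0`
  obtain ⟨ε, hεpos, hεlim⟩ := gluingLemma5_exists_seq_tendsto_zero
  have hF : Continuous fun t : unitInterval => (prodBernoulli (u t)).real (openConn a b) :=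
    (stub_weightContinuity n (openConn a b)).comp hucont
  have hlim : Tendsto (fun k => (prodBernoulli g).real (openConn v b ∩ E) +
      ((prodBernoulli (u (ε k))).real (openConn a b) - (prodBernoulli w).real (openConn a b)))
      atTop (𝓝 ((prodBernoulli g).real (openConn v b ∩ E) +
        ((prodBernoulli (u 0)).real (openConn a b) - (prodBernoulli w).real (openConn a b)))) :=
    tendsto_const_nhds.add (((hF.tendsto 0).comp hεlim).sub tendsto_const_nhds)
  rw [hu0, sub_self, add_zero] at hlim
  exact ge_of_tendsto' hlim fun k => hstep (ε k) (hεpos k)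

/-- **Lemma 5 for one pair, with a gap.**  `μ_g(j↔b) + γ ≤ μ_g(c↔b)` ⟹ after gluing `s(c,d)`:
`μ(j↔b) + γ·μ(j ↮ c) ≤ μ(c↔b)`. [cite: KozmaNitzan2024, Lemma 5 (p. 13); VandenbergHaggstromKahn2005, Thm. 1.2] -/
theorem pairGlue_gap (g : Sym2 (Fin n) → unitInterval) {c d : Fin n} (hcd : c ≠ d) (j b : Fin n) {γ : ℝ}
    (hγ : 0 ≤ γ) (hle : (prodBernoulli g).real (openConn j b) + γ ≤ (prodBernoulli g).real (openConn c b)) :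
    (prodBernoulli (fun f : Sym2 (Fin n) => if f = s(c, d) then 1 else g f)).real (openConn j b) +
      γ * (prodBernoulli (fun f : Sym2 (Fin n) => if f = s(c, d) then 1 else g f)).real (openConn j c)ᶜ ≤
      (prodBernoulli (fun f : Sym2 (Fin n) => if f = s(c, d) then 1 else g f)).real (openConn c b) := by
  have hE : ∀ ω ω' : BondConfig (Fin n), ω ∈ (univ : Set (BondConfig (Fin n))) →
      (∀ e : Sym2 (Fin n), (∀ x ∈ e, x ∈ ({c, d} : Finset (Fin n))) → ¬ e.IsDiag → e ∈ ω) →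
      openEdgeCluster ω c ⊆ openEdgeCluster ω' c →
      ω' ∈ (univ : Set (BondConfig (Fin n))) ∧
        ∀ e : Sym2 (Fin n), (∀ x ∈ e, x ∈ ({c, d} : Finset (Fin n))) → ¬ e.IsDiag → e ∈ ω' := by
    intro ω ω' _ hF hsub
    refine ⟨mem_univ _, fun e heS hed => ?_⟩
    have key := mem_openEdgeCluster_of_open_mem ({c, d} : Finset (Fin n)) c (by simp) ω hF
    have heω : e ∈ ω := hF e heS hed
    have hSne : ∃ x ∈ e, x ∈ ({c, d} : Finset (Fin n)) := by
      induction e using Sym2.ind with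
      | h x y => exact ⟨x, Sym2.mem_mk_left x y, heS x (Sym2.mem_mk_left x y)⟩
    exact openEdgeCluster_subset ω' c (hsub (key.2 e heω hed hSne))
  have hx := upsetExchange_event_gap g ({c, d} : Finset (Fin n)) j b c univ hγ hE hle
  rw [glue_pair_eq g hcd, inter_univ, inter_univ, inter_univ] at hx
  exact hx

end UpsetExchange

end

end Summit.CriticalPhenomena.PercolationContinuityZ3.Theorems
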